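import Literature.MathematicalPhysics.QuantumFieldTheory.Balaban1983to89.B7Eq136ThirdOrder

/-!
# `Balaban1983to89.B7Eq136Series` — T. Bałaban, *Averaging operations for lattice gauge theories*, Commun. Math. Phys. **98** (1985) 17–51
[Balaban1985Averaging], (136) p. 39: **«C_k(U₀, A) = C_k^{(2)}(U₀, A) + C_k^{(3)}(U₀, A) + …» AS A CONVERGENT SERIES ON THE CONCRETE `ℤᵈ`
CARRIER** — for every bounded bond field `B` with `‖B‖_∞ < b`, the remainder `C_j(U₀, B)(c)` of (134) IS the sum of its homogeneous terms
`C_j⁽ⁿ⁾(U₀, B)(c) := (n!)⁻¹·(dⁿ/dtⁿ)C_j(U₀, tB)(c)|₀`, the terms of order `0` and `1` vanish, orders `2`, `3` are `CCovIter2`/`CCovIter3`, and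
EVERY term obeys the Cauchy bound `‖C_j⁽ⁿ⁾(U₀, B)(c)‖ ≤ C₂(Lʲ)²b²·(‖B‖_∞/b)ⁿ` (so the tail after order `N` is `≤ C₂(Lʲ)²b²(‖B‖_∞/b)ᴺ/(1 − ‖B‖_∞/b)`)
— the «and so on» of [B11] (56)

statement-level skeleton of published theorems with citation tags; proofs where landed; nothing here is a claim about the Yang–Mills mass gap

PDF held: `paper:balaban1985-cmp98-averaging` (journal page = PDF page + 16), renders `…/1985-cmp98-averaging-p022-x2.png`, `-p023-x2.png`
(pp. 38–39) read as images (cell `b2b-balaban-ref1` page renders); `paper:balaban1985-cmp102-variational-background` p. 286 [PDF 10] (text layer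
`p0010.txt`).

CITATION HEADER / WHAT IS REPRODUCED.  Cell `lit-balaban` (HOME `run/shared/lean/pub/lit-balaban/`), Phase-2 proof seat p06 gen 6 = unit
`lit-balaban-p06` (TAKING line HOME/STATUS.md 2026-08-21T11:01:20Z + addendum; file 4 of the `C_j⁽ⁿ⁾` lane after `B7Eq136SecondOrder`,
`B7Eq136Expansion` (gen 5), `B7Eq136ThirdOrder`, `B7Eq136ThirdPolarization` (gen 6)); SKELETON rows **B7.Prop4 / B7.Eq127** (display (136);
owner r04 — r04's `B7Prop4GeneralCk.prop4_general_Ck_powerSeries` has (136) as the EXISTENCE of a power series with `p₀ = p₁ = 0` on the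
finitely many variables `𝔸^S`; this file has (136) for an ARBITRARY bounded bond field `B` on `ℤᵈ`, with the terms named and bounded) and
**B11.Eq55** ((56) «Σ_{n=2}^∞ C_j^{(n)}(…)», owner r08).  THE PRINT.  [B7] p. 38: *«Q_k(U₀, ηA) = Q_k(U₀)A + C_k(U₀, A), (134) and |C_k(U₀, A)| ≦
C₂|A|² < C₂α₁². (135)»*; p. 39: *«The function C_k can be decomposed further into a sum of homogeneous polynomials, C_k(U₀, A) = C_k^{(2)}(U₀,
A) + C_k^{(3)}(U₀, A) + … . (136)»*; (137) *«dF(A, δA) = (d/dt)F(A + tδA)|_{t=0}»*.  [B11] p. 286 (56): *«C_j(LʲηA′ − LʲηHD(A′)) = Σ_{n=2}^∞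
C_j^{(n)}(LʲηA′ − LʲηH Σ_{m=2}^∞ D^{(m)}(A′)) … where C_j^{(n)}, D^{(n)} are homogeneous polynomials of n-th order.»*  The convergence radius and
the geometric bounds below are printed nowhere (the print only asserts the decomposition); they are what Cauchy's estimate and the Taylor
series of the analytic slice give from Prop. 4's analyticity and (135) — our formalisation of (136) as a theorem about the concrete `C_j`.

DICTIONARY.  As `B7Eq136ThirdOrder`: `C_j(U₀, B)(c)` ↦ `CCovIter L U₀ B j z κ`; THIS FILE: **`C_j⁽ⁿ⁾(U₀, B)(c)` ↦ `CCovIterN L U₀ B j z κ n :=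
(n!)⁻¹·(dⁿ/dtⁿ)C_j(U₀, tB)(c)|_{t=0}`** (the `tⁿ`-coefficient of the complex slice `t ↦ C_j(U₀, tB)(c)`; `n = 2, 3` are `CCovIter2`, `CCovIter3`
definitionally); `B` ANY bond field on `ℤᵈ` with `‖B_b‖ ≤ β`; print's `C₂` of (135) ↦ `8·C₁·e^{4cα₀}` (local notation `C₂`); `|A|` ↦ `Lʲβ`.
Regime = Prop. 4's at a general background exactly as in `B7Eq136Expansion` / `B7Eq136ThirdOrder` (`L ≥ 2`, `AvgClosed` structure group, (52)
`pdev U₀ < α₀L^{−2k}`, `C₀α₀ ≤ ⅓`, `4α₀ ≤ c₂′`, witness radius `b > 0` with `hsmall`, `2Lᵏb ≤ c₃`), `j ≤ k`.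

WHAT THIS FILE PROVES (one definition with body + theorems; kernel, 0 sorry, standard axioms), for `j ≤ k`, `0 < β`, `‖B_b‖ ≤ β`:
* §1 `CCovIterN` (definition above), `CCovIterN_def`, `CCovIterN_two` (`= CCovIter2`), `CCovIterN_three` (`= CCovIter3`).
* §2 **(134)–(135) ⇒ NO TERMS OF ORDER 0 AND 1**: `CCovIterN_zero`, `CCovIterN_one` (the slice vanishes to second order at `0`; r08's
  `B11SchwarzRemainder.reading_begins_at_two` on (135) along the slice).
* §3 **CAUCHY BOUNDS FOR EVERY ORDER**: `norm_iteratedDeriv_CCovIter_slice_le` (`‖(dⁿ/dtⁿ)C_j(U₀, tB)(c)|₀‖ ≤ n!·C₂(Lʲ)²b²/(b/β)ⁿ`),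
  **`norm_CCovIterN_le`** (`‖C_j⁽ⁿ⁾(U₀, B)(c)‖ ≤ C₂(Lʲ)²b²·(β/b)ⁿ` — the homogeneous terms decay geometrically inside the witness radius);
  **`CCovIterN_smul`** (`C_j⁽ⁿ⁾(U₀, s·B)(c) = sⁿ·C_j⁽ⁿ⁾(U₀, B)(c)`, every `s ∈ ℂ`: «homogeneous polynomials of n-th order»; §1b = the generic
  scaling of slice derivatives), `CCovIter2_smul_and_CCovIter3_smul`.
* §4 **(136) AS A CONVERGENT SERIES**: `hasFPowerSeriesOnBall_CCovIter_slice` (the slice has a power series on the disc `|t| < b/β`, Mathlib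
  `DiffContOnCl.hasFPowerSeriesOnBall`), **`hasSum_CCovIterN_slice`** (`Σ_n tⁿ·C_j⁽ⁿ⁾(U₀, B)(c) = C_j(U₀, tB)(c)` for `|t| < b/β`),
  **`hasSum_CCovIterN`** (for `β < b`: `Σ_n C_j⁽ⁿ⁾(U₀, B)(c) = C_j(U₀, B)(c)` — (136) VERBATIM, the sum starting in effect at `n = 2` by §2),
  `CCovIter_eq_tsum`, **`norm_CCovIter_sub_partialSum_le`** (`‖C_j(U₀, B)(c) − Σ_{n<N} C_j⁽ⁿ⁾(U₀, B)(c)‖ ≤ C₂(Lʲ)²b²(β/b)ᴺ(1 − β/b)⁻¹` — the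
  remainder after ANY order, of which `B7Eq136Expansion`/`B7Eq136ThirdOrder` gave `N = 3, 4` with sharper constants).
NOT CLAIMED: the polarizations of `C⁽ⁿ⁾`, `n ≥ 4`, and (149)-type bounds for them (orders 2, 3: `B7Eq136SecondOrder`,
`B7Eq136ThirdPolarization`); optimality of constants.  NOT summit progress.
-/

noncomputable section

open scoped BigOperators Topology NNReal
open NormedSpace Finset Metric Filter

namespace Literature.MathematicalPhysics.QuantumFieldTheory.Balaban1983to89.B7Eq136Series

open B7Prop1Explicit B7Prop1Local B7Prop2Explicit B7Prop3Flat B7Prop4Flat B7Eq92Concrete B7Prop3GeneralLinear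
  B7Prop4GeneralLevels B7Prop5GeneralInduction B7Prop5GeneralLevels B7Eq136SecondOrder B7Eq136Expansion B7Eq136ThirdOrder
open B11SchwarzRemainder (reading_begins_at_two)

-- `Site` alone would resolve to the torus sites of `Setup.lean`; re-export the `ℤ^d` sites of `B7Prop1Explicit`.
export B7Prop1Explicit (Site)

variable {d : ℕ}

/-! ## §1 The homogeneous terms `C_j⁽ⁿ⁾(U₀, B)(c)` -/

section Def

variable {𝔸 : Type*} [NormedRing 𝔸] [NormedAlgebra ℂ 𝔸] [CompleteSpace 𝔸]

/-- **`C_j⁽ⁿ⁾(U₀, B)(c)`, THE TERM OF ORDER `n` of the remainder `C_j(U₀, ·)(c)`** — [B7] (136) «C_k(U₀, A) = C_k^{(2)}(U₀, A) + C_k^{(3)}(U₀, A)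
+ …», [B11] (56) «Σ_{n=2}^∞ C_j^{(n)}(…) … homogeneous polynomials of n-th order»: the `tⁿ`-coefficient `(n!)⁻¹·(dⁿ/dtⁿ)C_j(U₀, t·B)(c)|_{t=0}`
of the complex slice ([B7] (137)); `n = 2, 3` are `B7Eq136SecondOrder.CCovIter2`, `B7Eq136ThirdOrder.CCovIter3`.
[cite: Balaban1985Averaging, (136) p.39, (137) p.39] [cite: Balaban1985Variational, (56) p.286] -/
def CCovIterN (L : ℕ) (U₀ : Site d → Fin d → 𝔸ˣ) (B : Site d → Fin d → 𝔸) (j : ℕ) (z : Site d) (κ : Fin d) (n : ℕ) : 𝔸 :=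
  ((Nat.factorial n : ℕ) : ℂ)⁻¹ • iteratedDeriv n (fun t : ℂ => CCovIter L U₀ (t • B) j z κ) 0

/-- `CCovIterN` unfolded. [cite: Balaban1985Averaging, (136) p.39] -/
theorem CCovIterN_def (L : ℕ) (U₀ : Site d → Fin d → 𝔸ˣ) (B : Site d → Fin d → 𝔸) (j : ℕ) (z : Site d) (κ : Fin d) (n : ℕ) :
    CCovIterN L U₀ B j z κ n = ((Nat.factorial n : ℕ) : ℂ)⁻¹ • iteratedDeriv n (fun t : ℂ => CCovIter L U₀ (t • B) j z κ) 0 := rfl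

/-- the term of order two is `C_j⁽²⁾` of `B7Eq136SecondOrder`. [cite: Balaban1985Averaging, (136) p.39] -/
theorem CCovIterN_two (L : ℕ) (U₀ : Site d → Fin d → 𝔸ˣ) (B : Site d → Fin d → 𝔸) (j : ℕ) (z : Site d) (κ : Fin d) :
    CCovIterN L U₀ B j z κ 2 = CCovIter2 L U₀ B j z κ := by
  rw [CCovIterN_def, CCovIter2_def]
  norm_num [Nat.factorial]

/-- the term of order three is `C_j⁽³⁾` of `B7Eq136ThirdOrder`. [cite: Balaban1985Averaging, (136) p.39] -/
theorem CCovIterN_three (L : ℕ) (U₀ : Site d → Fin d → 𝔸ˣ) (B : Site d → Fin d → 𝔸) (j : ℕ) (z : Site d) (κ : Fin d) :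
    CCovIterN L U₀ B j z κ 3 = CCovIter3 L U₀ B j z κ := rfl

end Def

/-! ## §1b Scaling of slice derivatives (generic, private) -/

section Scaling

variable {F : Type*} [NormedAddCommGroup F] [NormedSpace ℂ F] [CompleteSpace F]

/-- for `ψ` analytic near `0` and any `s ∈ ℂ`: near `t = 0`, `(dⁿ/dtⁿ)[ψ(s·t)] = sⁿ·ψ⁽ⁿ⁾(s·t)` (chain rule `n` times; derivatives of
eventually equal functions agree). [folklore] -/
private theorem iteratedDeriv_comp_mul_eventually {ψ : ℂ → F} (hψ : ∀ᶠ u in 𝓝 (0 : ℂ), AnalyticAt ℂ ψ u) (s : ℂ) (n : ℕ) :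
    ∀ᶠ t in 𝓝 (0 : ℂ), iteratedDeriv n (fun u : ℂ => ψ (s * u)) t = s ^ n • iteratedDeriv n ψ (s * t) := by
  have hline : Tendsto (fun t : ℂ => s * t) (𝓝 0) (𝓝 0) := by
    have hc : Continuous (fun t : ℂ => s * t) := continuous_const_mul s
    simpa using hc.tendsto 0
  have hev : ∀ᶠ t : ℂ in 𝓝 0, AnalyticAt ℂ ψ (s * t) := hline.eventually hψ
  induction n with
  | zero => exact Eventually.of_forall fun t => by simp
  | succ n ih =>
    filter_upwards [ih.eventually_nhds, hev] with t ht han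
    rw [iteratedDeriv_succ, Filter.EventuallyEq.deriv_eq ht]
    have hψn : AnalyticAt ℂ (iteratedDeriv n ψ) (s * t) := by
      rw [iteratedDeriv_eq_iterate]; exact han.iterated_deriv n
    have h1 : HasDerivAt (fun u : ℂ => s * u) s t := by simpa using (hasDerivAt_id t).const_mul s
    have h2 : HasDerivAt (iteratedDeriv n ψ) (iteratedDeriv (n + 1) ψ (s * t)) (s * t) := by
      rw [iteratedDeriv_succ]; exact hψn.differentiableAt.hasDerivAt
    have h3 := (h2.scomp t h1).const_smul (s ^ n)
    rw [show deriv (fun u : ℂ => s ^ n • iteratedDeriv n ψ (s * u)) t = s ^ n • s • iteratedDeriv (n + 1) ψ (s * t)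
      from h3.deriv, smul_smul, pow_succ]

end Scaling

/-! ## §2–§4 Along the slice: vanishing of orders 0, 1; Cauchy bounds; the convergent series (136) -/

section Regime

variable {𝔸 : Type*} [NormedRing 𝔸] [NormedAlgebra ℂ 𝔸] [CompleteSpace 𝔸] [NormOneClass 𝔸]

variable (L : ℕ) (hL : 2 ≤ L) {G : Subgroup 𝔸ˣ} (hG : AvgClosed d L G) (k : ℕ)
  (U₀ : Site d → Fin d → 𝔸ˣ) (hU₀ : ∀ x κ, U₀ x κ ∈ G) {α₀ : ℝ} (hα : 0 < α₀)
  (hα3 : C0 d * α₀ ≤ 1 / 3) (hα4 : 4 * α₀ ≤ c2' d L) (h52 : pdev U₀ < α₀ * (((L : ℝ) ^ k)⁻¹) ^ 2)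
  {b : ℝ} (hb : 0 < b)
  (hsmall : Real.exp (4 * (800 * ((d : ℝ) + 1) ^ 2 * ((d : ℝ) + 4)) * α₀)
    * (1 + 8 * (131072 * ((d : ℝ) + 1) ^ 2) * ((L : ℝ) ^ k * b)) ≤ 2)
  (hc₃ : 2 * ((L : ℝ) ^ k * b) ≤ c3 d L)
  {B : Site d → Fin d → 𝔸} {β : ℝ} (hβ : 0 < β) (hB : ∀ x κ, ‖B x κ‖ ≤ β)

/-- print's `C₂` of (135) at a general background (`B7Eq123General.prop4_general` (i)): `8·C₁·e^{4cα₀}`. -/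
local notation "C₂" => (8 * (131072 * ((d : ℝ) + 1) ^ 2) * Real.exp (4 * (800 * ((d : ℝ) + 1) ^ 2 * ((d : ℝ) + 4)) * α₀))

include hL hG hU₀ hα hα3 hα4 h52 hb hsmall hc₃ hβ hB in
/-- **(134)–(135) ⇒ the slice vanishes to second order at `0`**: `C_j(U₀, 0·B)(c) = 0` and `(d/dt)C_j(U₀, tB)(c)|₀ = 0` (r08's
`B11SchwarzRemainder.reading_begins_at_two` on the bound `‖C_j(U₀, tB)(c)‖ ≤ C₂(Lʲβ)²|t|²`, `B7Eq136Expansion.norm_CCovIter_slice_le`).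
[cite: Balaban1985Averaging, (134)–(135) p.38, (136) p.39] -/
theorem slice_zero_and_deriv_zero {j : ℕ} (hj : j ≤ k) (z : Site d) (κ : Fin d) :
    CCovIter L U₀ ((0 : ℂ) • B) j z κ = 0 ∧ deriv (fun t : ℂ => CCovIter L U₀ (t • B) j z κ) 0 = 0 := by
  have hr : 0 < b / β := div_pos hb hβ
  have hK : 0 ≤ C₂ * ((L : ℝ) ^ j * β) ^ 2 / 4 := by positivity
  have h := reading_begins_at_two hK hr
    (differentiableOn_CCovIter_slice L hL hG k U₀ hU₀ hα hα3 hα4 h52 hsmall hc₃ hβ hB hj z κ)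
    (fun t ht => by
      have h1 := norm_CCovIter_slice_le L hL hG k U₀ hU₀ hα hα3 hα4 h52 hsmall hc₃ hβ hB hj z κ ht
      refine h1.trans (le_of_eq ?_)
      ring)
  exact h

include hL hG hU₀ hα hα3 hα4 h52 hb hsmall hc₃ hβ hB in
/-- **NO TERM OF ORDER ZERO**: `C_j⁽⁰⁾(U₀, B)(c) = 0` ((134): `C_j(U₀, 0) = 0`). [cite: Balaban1985Averaging, (134)–(136) pp.38–39] -/
theorem CCovIterN_zero {j : ℕ} (hj : j ≤ k) (z : Site d) (κ : Fin d) : CCovIterN L U₀ B j z κ 0 = 0 := by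
  rw [CCovIterN_def, iteratedDeriv_zero, (slice_zero_and_deriv_zero L hL hG k U₀ hU₀ hα hα3 hα4 h52 hb hsmall hc₃ hβ hB hj z κ).1,
    smul_zero]

include hL hG hU₀ hα hα3 hα4 h52 hb hsmall hc₃ hβ hB in
/-- **NO TERM OF ORDER ONE**: `C_j⁽¹⁾(U₀, B)(c) = 0` ((135): the slice is `O(t²)`; «a power series expansion … begins with second order terms»).
[cite: Balaban1985Averaging, (135)–(136) pp.38–39] [cite: Balaban1985Variational, (55)–(56) p.286] -/
theorem CCovIterN_one {j : ℕ} (hj : j ≤ k) (z : Site d) (κ : Fin d) : CCovIterN L U₀ B j z κ 1 = 0 := by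
  rw [CCovIterN_def, iteratedDeriv_one, (slice_zero_and_deriv_zero L hL hG k U₀ hU₀ hα hα3 hα4 h52 hb hsmall hc₃ hβ hB hj z κ).2,
    smul_zero]

include hL hG hU₀ hα hα3 hα4 h52 hb hsmall hc₃ hβ hB in
/-- **CAUCHY'S ESTIMATE FOR EVERY SLICE DERIVATIVE**: `‖(dⁿ/dtⁿ)C_j(U₀, tB)(c)|_{t=0}‖ ≤ n!·C₂(Lʲ)²b²/(b/β)ⁿ` (Mathlib
`Complex.norm_iteratedDeriv_le_of_forall_mem_sphere_norm_le` on the circle `|t| = b/β`, where (135) gives `‖C_j(U₀, tB)(c)‖ ≤ C₂(Lʲ)²b²`;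
`B7Eq136ThirdOrder.diffContOnCl_CCovIter_slice`, `norm_CCovIter_slice_le_closed`). [cite: Balaban1985Averaging, (135)–(136) pp.38–39] -/
theorem norm_iteratedDeriv_CCovIter_slice_le {j : ℕ} (hj : j ≤ k) (z : Site d) (κ : Fin d) (n : ℕ) :
    ‖iteratedDeriv n (fun t : ℂ => CCovIter L U₀ (t • B) j z κ) 0‖ ≤
      (Nat.factorial n : ℕ) * (C₂ * ((L : ℝ) ^ j) ^ 2 * b ^ 2) / (b / β) ^ n := by
  have hR : 0 < b / β := div_pos hb hβ
  have hsph : ∀ t ∈ sphere (0 : ℂ) (b / β), ‖CCovIter L U₀ (t • B) j z κ‖ ≤ C₂ * ((L : ℝ) ^ j) ^ 2 * b ^ 2 := by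
    intro t ht
    have htn : ‖t‖ = b / β := by simpa using ht
    have ht' : ‖t‖ * β ≤ b := by rw [htn, div_mul_cancel₀ b hβ.ne']
    have h := norm_CCovIter_slice_le_closed L hL hG k U₀ hU₀ hα hα3 hα4 h52 hsmall hc₃ hβ hB hj z κ ht'
    refine h.trans (le_of_eq ?_)
    rw [htn]
    field_simp
  exact Complex.norm_iteratedDeriv_le_of_forall_mem_sphere_norm_le n hR
    (diffContOnCl_CCovIter_slice L hL hG k U₀ hU₀ hα hα3 hα4 h52 hb hsmall hc₃ hβ hB hj z κ) hsph

include hL hG hU₀ hα hα3 hα4 h52 hb hsmall hc₃ hβ hB in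
/-- **THE HOMOGENEOUS TERMS DECAY GEOMETRICALLY**: `‖C_j⁽ⁿ⁾(U₀, B)(c)‖ ≤ C₂·(Lʲ)²·b²·(β/b)ⁿ` for every `n` — Cauchy's estimate divided by `n!`;
at `n = 2`: `C₂(Lʲβ)²` = (135) for `C^{(2)}` (`B7Eq136Expansion.norm_CCovIter2_le_C2`), at `n = 3`: `C₂(Lʲ)²β³/b` (`B7Eq136ThirdOrder.norm_CCovIter3_le`).
[cite: Balaban1985Averaging, (135)–(136) pp.38–39] [cite: Balaban1985Variational, (56) p.286] -/
theorem norm_CCovIterN_le {j : ℕ} (hj : j ≤ k) (z : Site d) (κ : Fin d) (n : ℕ) :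
    ‖CCovIterN L U₀ B j z κ n‖ ≤ C₂ * ((L : ℝ) ^ j) ^ 2 * b ^ 2 * (β / b) ^ n := by
  have h := norm_iteratedDeriv_CCovIter_slice_le L hL hG k U₀ hU₀ hα hα3 hα4 h52 hb hsmall hc₃ hβ hB hj z κ n
  have hn : (0 : ℝ) < ((Nat.factorial n : ℕ) : ℝ) := by exact_mod_cast Nat.factorial_pos n
  rw [CCovIterN_def, norm_smul, norm_inv, Complex.norm_natCast, inv_mul_le_iff₀ hn]
  refine h.trans (le_of_eq ?_)
  have hb0 : b ≠ 0 := hb.ne'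
  have hβ0 : β ≠ 0 := hβ.ne'
  rw [div_pow, div_pow]
  field_simp

include hL hG hU₀ hα hα3 hα4 h52 hb hsmall hc₃ hβ hB in
/-- **THE TERMS ARE HOMOGENEOUS POLYNOMIALS**: `C_j⁽ⁿ⁾(U₀, s·B)(c) = sⁿ·C_j⁽ⁿ⁾(U₀, B)(c)` for every `s ∈ ℂ` and every `n` («homogeneous
polynomials of n-th order», [B11] (56); «a sum of homogeneous polynomials», [B7] (136)) — the slice through `sB` is `t ↦ C_j(U₀, (st)B)(c)`,
whose `n`-th derivative at `0` is `sⁿ` times that of the slice through `B`. [cite: Balaban1985Averaging, (136) p.39]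
[cite: Balaban1985Variational, (56) p.286] -/
theorem CCovIterN_smul {j : ℕ} (hj : j ≤ k) (z : Site d) (κ : Fin d) (s : ℂ) (n : ℕ) :
    CCovIterN L U₀ (s • B) j z κ n = s ^ n • CCovIterN L U₀ B j z κ n := by
  have hψ : ∀ᶠ u in 𝓝 (0 : ℂ), AnalyticAt ℂ (fun t : ℂ => CCovIter L U₀ (t • B) j z κ) u := by
    filter_upwards [closedBall_mem_nhds (0 : ℂ) (div_pos hb hβ)] with u hu
    rw [mem_closedBall_zero_iff] at hu
    exact analyticAt_CCovIter_slice L hL hG k U₀ hU₀ hα hα3 hα4 h52 hsmall hc₃ hβ hB hj z κ ((le_div_iff₀ hβ).1 hu)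
  have h := (iteratedDeriv_comp_mul_eventually hψ s n).self_of_nhds
  rw [mul_zero] at h
  have hfun : (fun t : ℂ => CCovIter L U₀ (t • (s • B)) j z κ) =
      fun u : ℂ => (fun t : ℂ => CCovIter L U₀ (t • B) j z κ) (s * u) := by
    funext u
    simp only [smul_smul, mul_comm u s]
  rw [CCovIterN_def, CCovIterN_def, hfun, h, smul_smul, smul_smul, mul_comm]

include hL hG hU₀ hα hα3 hα4 h52 hb hsmall hc₃ hβ hB in
/-- in particular `C_j⁽²⁾(U₀, s·B)(c) = s²·C_j⁽²⁾(U₀, B)(c)` and `C_j⁽³⁾(U₀, s·B)(c) = s³·C_j⁽³⁾(U₀, B)(c)` for every bounded `B` (not only on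
the finitely many variables of `B7Eq136SecondOrder.CCovIter2_ins_smul`). [cite: Balaban1985Averaging, (136) p.39] -/
theorem CCovIter2_smul_and_CCovIter3_smul {j : ℕ} (hj : j ≤ k) (z : Site d) (κ : Fin d) (s : ℂ) :
    CCovIter2 L U₀ (s • B) j z κ = s ^ 2 • CCovIter2 L U₀ B j z κ ∧
      CCovIter3 L U₀ (s • B) j z κ = s ^ 3 • CCovIter3 L U₀ B j z κ := by
  refine ⟨?_, ?_⟩
  · rw [← CCovIterN_two, ← CCovIterN_two]
    exact CCovIterN_smul L hL hG k U₀ hU₀ hα hα3 hα4 h52 hb hsmall hc₃ hβ hB hj z κ s 2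
  · rw [← CCovIterN_three, ← CCovIterN_three]
    exact CCovIterN_smul L hL hG k U₀ hU₀ hα hα3 hα4 h52 hb hsmall hc₃ hβ hB hj z κ s 3

include hL hG hU₀ hα hα3 hα4 h52 hb hsmall hc₃ hβ hB in
/-- **THE SLICE HAS A POWER SERIES ON THE WHOLE DISC `|t| < b/β`** (Mathlib `DiffContOnCl.hasFPowerSeriesOnBall`, Cauchy's integral formula;
`B7Eq136ThirdOrder.diffContOnCl_CCovIter_slice`). [cite: Balaban1985Averaging, Prop. 4 p.38, (136) p.39] -/
theorem hasFPowerSeriesOnBall_CCovIter_slice {j : ℕ} (hj : j ≤ k) (z : Site d) (κ : Fin d) :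
    HasFPowerSeriesOnBall (fun t : ℂ => CCovIter L U₀ (t • B) j z κ)
      (cauchyPowerSeries (fun t : ℂ => CCovIter L U₀ (t • B) j z κ) 0 (b / β)) 0 (ENNReal.ofReal (b / β)) := by
  have hR : 0 < b / β := div_pos hb hβ
  have hd := diffContOnCl_CCovIter_slice L hL hG k U₀ hU₀ hα hα3 hα4 h52 hb hsmall hc₃ hβ hB hj z κ
  -- the radius as a nonnegative real, for Mathlib's Cauchy power series
  set R : ℝ≥0 := Real.toNNReal (b / β) with hRdef
  have hcoe : (R : ℝ) = b / β := Real.coe_toNNReal _ hR.le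
  have hRpos : 0 < R := by
    rw [← NNReal.coe_pos, hcoe]; exact hR
  have hd' : DiffContOnCl ℂ (fun t : ℂ => CCovIter L U₀ (t • B) j z κ) (ball (0 : ℂ) (R : ℝ)) := by rwa [hcoe]
  have h := hd'.hasFPowerSeriesOnBall hRpos
  rw [hcoe] at h
  have he : (R : ENNReal) = ENNReal.ofReal (b / β) := by
    rw [← hcoe, ENNReal.ofReal_coe_nnreal]
  rwa [he] at h

include hL hG hU₀ hα hα3 hα4 h52 hb hsmall hc₃ hβ hB in
/-- **(136) ALONG THE SLICE, AS A CONVERGENT SERIES**: for `|t| < b/β`, `Σ_{n≥0} tⁿ·C_j⁽ⁿ⁾(U₀, B)(c) = C_j(U₀, tB)(c)` (the Taylor series of the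
analytic slice, Mathlib `HasFPowerSeriesOnBall.hasSum_iteratedFDeriv`). [cite: Balaban1985Averaging, (136)–(137) p.39]
[cite: Balaban1985Variational, (56) p.286] -/
theorem hasSum_CCovIterN_slice {j : ℕ} (hj : j ≤ k) (z : Site d) (κ : Fin d) {t : ℂ} (ht : ‖t‖ < b / β) :
    HasSum (fun n : ℕ => t ^ n • CCovIterN L U₀ B j z κ n) (CCovIter L U₀ (t • B) j z κ) := by
  have hps := hasFPowerSeriesOnBall_CCovIter_slice L hL hG k U₀ hU₀ hα hα3 hα4 h52 hb hsmall hc₃ hβ hB hj z κ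
  have hy : t ∈ Metric.eball (0 : ℂ) (ENNReal.ofReal (b / β)) := by
    rw [Metric.mem_eball, edist_dist, dist_zero_right]
    exact (ENNReal.ofReal_lt_ofReal_iff (div_pos hb hβ)).2 ht
  have h := hps.hasSum_iteratedFDeriv hy
  rw [zero_add] at h
  have key : (fun n : ℕ => t ^ n • CCovIterN L U₀ B j z κ n) = fun n : ℕ =>
      ((Nat.factorial n : ℕ) : ℂ)⁻¹ • iteratedFDeriv ℂ n (fun t : ℂ => CCovIter L U₀ (t • B) j z κ) 0 fun _ => t := by
    funext n
    rw [iteratedFDeriv_apply_eq_iteratedDeriv_mul_prod, Finset.prod_const, Finset.card_univ, Fintype.card_fin,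
      CCovIterN_def, smul_smul, smul_smul, mul_comm]
  rw [key]
  exact h

include hL hG hU₀ hα hα3 hα4 h52 hb hsmall hc₃ hβ hB in
/-- **(136) VERBATIM ON THE CONCRETE CARRIER**: for a field `B` with `‖B_b‖ ≤ β < b`,
`Σ_{n≥0} C_j⁽ⁿ⁾(U₀, B)(c) = C_j(U₀, B)(c)` — «C_k(U₀, A) = C_k^{(2)}(U₀, A) + C_k^{(3)}(U₀, A) + …» (the terms `n = 0, 1` vanish by
`CCovIterN_zero`/`CCovIterN_one`; `n = 2, 3` are `CCovIter2`, `CCovIter3`). [cite: Balaban1985Averaging, (136) p.39]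
[cite: Balaban1985Variational, (56) p.286] -/
theorem hasSum_CCovIterN {j : ℕ} (hj : j ≤ k) (z : Site d) (κ : Fin d) (hβb : β < b) :
    HasSum (fun n : ℕ => CCovIterN L U₀ B j z κ n) (CCovIter L U₀ B j z κ) := by
  have h1 : ‖(1 : ℂ)‖ < b / β := by
    rw [norm_one]
    exact (one_lt_div hβ).2 hβb
  have h := hasSum_CCovIterN_slice L hL hG k U₀ hU₀ hα hα3 hα4 h52 hb hsmall hc₃ hβ hB hj z κ h1
  simp only [one_pow, one_smul] at h
  exact h

include hL hG hU₀ hα hα3 hα4 h52 hb hsmall hc₃ hβ hB in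
/-- (136) in `tsum` form: `C_j(U₀, B)(c) = Σ'_n C_j⁽ⁿ⁾(U₀, B)(c)` for `‖B_b‖ ≤ β < b`. [cite: Balaban1985Averaging, (136) p.39] -/
theorem CCovIter_eq_tsum {j : ℕ} (hj : j ≤ k) (z : Site d) (κ : Fin d) (hβb : β < b) :
    CCovIter L U₀ B j z κ = ∑' n : ℕ, CCovIterN L U₀ B j z κ n :=
  (hasSum_CCovIterN L hL hG k U₀ hU₀ hα hα3 hα4 h52 hb hsmall hc₃ hβ hB hj z κ hβb).tsum_eq.symm

include hL hG hU₀ hα hα3 hα4 h52 hb hsmall hc₃ hβ hB in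
/-- **THE REMAINDER OF (136) AFTER ANY ORDER**: for `‖B_b‖ ≤ β < b` and every `N`,
`‖C_j(U₀, B)(c) − Σ_{n<N} C_j⁽ⁿ⁾(U₀, B)(c)‖ ≤ C₂(Lʲ)²b²·(β/b)ᴺ·(1 − β/b)⁻¹` (the tail of the series, bounded termwise by `norm_CCovIterN_le` and
summed geometrically). [cite: Balaban1985Averaging, (136) p.39] [cite: Balaban1985Variational, (56) p.286] -/
theorem norm_CCovIter_sub_partialSum_le {j : ℕ} (hj : j ≤ k) (z : Site d) (κ : Fin d) (hβb : β < b) (N : ℕ) :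
    ‖CCovIter L U₀ B j z κ - ∑ n ∈ Finset.range N, CCovIterN L U₀ B j z κ n‖ ≤
      C₂ * ((L : ℝ) ^ j) ^ 2 * b ^ 2 * (β / b) ^ N * (1 - β / b)⁻¹ := by
  set r : ℝ := β / b with hr
  have hr0 : 0 ≤ r := (div_pos hβ hb).le
  have hr1 : r < 1 := (div_lt_one hb).2 hβb
  set K : ℝ := C₂ * ((L : ℝ) ^ j) ^ 2 * b ^ 2 with hK
  have hK0 : 0 ≤ K := by positivity
  have hf := (hasSum_nat_add_iff' N).2
    (hasSum_CCovIterN L hL hG k U₀ hU₀ hα hα3 hα4 h52 hb hsmall hc₃ hβ hB hj z κ hβb)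
  have hg : HasSum (fun n : ℕ => K * r ^ N * r ^ n) (K * r ^ N * (1 - r)⁻¹) :=
    (hasSum_geometric_of_lt_one hr0 hr1).mul_left (K * r ^ N)
  have hle : ∀ n : ℕ, ‖CCovIterN L U₀ B j z κ (n + N)‖ ≤ K * r ^ N * r ^ n := by
    intro n
    have h := norm_CCovIterN_le L hL hG k U₀ hU₀ hα hα3 hα4 h52 hb hsmall hc₃ hβ hB hj z κ (n + N)
    refine h.trans (le_of_eq ?_)
    rw [hK, hr, pow_add]
    ring
  have h := hf.norm_le_of_bounded hg hle
  refine h.trans (le_of_eq ?_)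
  rw [hK, hr]

end Regime

end Literature.MathematicalPhysics.QuantumFieldTheory.Balaban1983to89.B7Eq136Series

end
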